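import Literature.NumberTheory.EllipticCurves.ModularCurve
import Literature.NumberTheory.EllipticCurves.UniformizationProofs
import HarnessLib

/-!
# Discharge of `Literature.NumberTheory.EllipticCurves.ModularForms.exists_isNeronLatticeOf` (Silverman AEC VI.5.1, curve form)

The named fact `Literature.NumberTheory.EllipticCurves.ModularForms.exists_isNeronLatticeOf` of
`Literature/NumberTheory/EllipticCurves/ModularCurve.lean` — every elliptic curve `W/ℂ` has a
period pair `L` with `g₂(L) = c₄/12`, `g₃(L) = c₆/216` — is the special case `A = c₄/12`,
`B = c₆/216` of the Uniformization Theorem `PeriodPair.uniformization` (Silverman AEC VI.5.1,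
`Literature/…/Uniformization.lean`), proved as `PeriodPair.uniformization_holds`
(`UniformizationProofs.lean`, via Mathlib's level-one modular forms), since
`(c₄/12)³ − 27(c₆/216)² = (c₄³ − c₆²)/1728 = Δ ≠ 0` (Mathlib `WeierstrassCurve.c_relation`;
cf. `WeierstrassCurve.c₄_div_cube_sub_eq_Δ` in `ComplexPeriod.lean`, not imported to keep this
file low in the import graph).  This closes the follow-up recorded in the module docstring of
`Uniformization.lean`.

## References

* J. H. Silverman, *The Arithmetic of Elliptic Curves*, 2nd ed., GTM 106, Springer 2009,
  Thm. VI.5.1 (PDF p. 154), Prop. VI.3.6.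
-/

noncomputable section

namespace Literature.NumberTheory.EllipticCurves.ModularForms

/-- **Discharge** of `exists_isNeronLatticeOf` (Silverman AEC Thm. VI.5.1, existence, for the
invariants `A = c₄/12`, `B = c₆/216` of an elliptic curve over `ℂ`, admissible because
`A³ − 27B² = Δ ≠ 0`). [cite: SilvermanAEC2009, Thm. VI.5.1] -/
theorem exists_isNeronLatticeOf_holds : exists_isNeronLatticeOf := by
  intro W hW
  have hAB : (W.c₄ / 12) ^ 3 - 27 * (W.c₆ / 216) ^ 2 = W.Δ := by
    rw [show (W.c₄ / 12) ^ 3 - 27 * (W.c₆ / 216) ^ 2 = (W.c₄ ^ 3 - W.c₆ ^ 2) / 1728 by ring,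
      ← W.c_relation]
    ring
  have hne : (W.c₄ / 12) ^ 3 - 27 * (W.c₆ / 216) ^ 2 ≠ 0 := hAB ▸ W.isUnit_Δ.ne_zero
  obtain ⟨L, h₂, h₃⟩ := PeriodPair.uniformization_holds _ _ hne
  exact ⟨L, h₂, h₃⟩

end Literature.NumberTheory.EllipticCurves.ModularForms

end
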